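import Summits.FinalStateConjecture.FinalStateConjecture.Theorems.EIHFluxBalanceInertialRecessionStubSlavingImmersion

/-!
# Route EIHFluxBalance — `InertialRecession`, line `sublinear-is-free-clean-window-charges`:
# a late-time `C⁰` bound for the frozen ansatz on hole-following tubes (slaving stub `stub_slaving`)

Helper file for the crux `stmt-FinalStateConjecture-10166`
(`Summit.FinalStateConjecture.FinalStateConjecture.Theses.EIHFluxBalance.InertialRecession`),
stub `stub_slaving`. The `C³` capstone of the slaving analysis (`…StubSlaving11RicciC3`) places
the zoomed ansatz in a COMPACT box of jets, which needs, besides the coercivity of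
`eventually_coercive_near_hole` (`…StubSlaving3Coercive`), an upper bound for `‖g₀(x)‖` on the
hole-following tubes:

* `eventually_norm_ansatz_le_near_hole` — eventually in the lab time, on
  `{x⁰ = t, ‖x̲ − ξᵢ(t)‖ ≤ R, rᵢ ≥ r₀}`: `‖g₀(x)‖ ≤ ‖η‖ + Σⱼ 4 (|Mⱼ| / min r₀ 1) (1 + 3γ)²`
  (each summand is `≤ 4|H|‖Λ⁻¹‖²`, `norm_boostedKerrBilin_sub_minkowski_le` of
  `…StubSlavingImmersion`, `|H| ≤ |M|/r`, `‖Λ⁻¹‖ ≤ 1 + 3γ`; the other holes' painted radii are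
  eventually `≥ 1` on the tube because their centres recede, `sq_sub_sq_le_radius_poincareInv_sq`);
* `norm_fderiv_fderiv_fderiv_eq_norm_iteratedFDeriv` — `‖D(D(Df))(x)‖ = ‖D³f(x)‖` (bookkeeping
  for the `3`-jet of the deviation).

Elementary; no definitions, no named facts.
-/

set_option linter.dupNamespace false
set_option maxSynthPendingDepth 6
set_option synthInstance.maxHeartbeats 200000

noncomputable section

open scoped Topology Manifold ContDiff
open Filter Set Function TopologicalSpace Literature.Geometry.Lorentzian
  Literature.Geometry.Lorentzian.MetricCoord Summit.FinalStateConjecture.FinalStateConjecture.Theorems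

namespace Summit.FinalStateConjecture.FinalStateConjecture.Theorems.SublinearIsFree.Slaving

/-! ### A late-time bound for the ansatz on hole-following tubes -/

/-- **The frozen ansatz is bounded on hole-following tubes at late times**: with
`α = ‖η‖ + Σⱼ 4 (|Mⱼ| / min r₀ 1) (1 + 3γ)²`, eventually in the lab time `t`, at every chart point
`x` of the slab `{x⁰ = t}` with `‖x̲ − ξᵢ(t)‖ ≤ R` and `rᵢ(x) ≥ r₀`: `‖g₀(x)‖ ≤ α` (each summand is
`≤ 4|H|‖Λ⁻¹‖²`, `norm_boostedKerrBilin_sub_minkowski_le`, `|H| ≤ |M|/r`, and the other holes'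
painted radii are eventually `≥ 1` there because their centres recede). [folklore] -/
theorem eventually_norm_ansatz_le_near_hole {N : ℕ} {M a : Fin N → ℝ}
    {Λ : Fin N → ℝ → lorentzGroup} {ξ : Fin N → ℝ → E3} {γ : ℝ}
    (hγ : ∀ i t, |((Λ i t : E4 ≃L[ℝ] E4) (E4.basisVector 0)) 0| ≤ γ)
    (hsep : ∀ i j, i ≠ j → Tendsto (fun t ↦ ‖ξ i t - ξ j t‖) atTop atTop)
    (i : Fin N) (R : ℝ) {r₀ : ℝ} (hr₀ : 0 < r₀) :
    ∀ᶠ t in atTop, ∀ x : E4, x 0 = t → ‖E4.spatial x - ξ i t‖ ≤ R →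
      r₀ ≤ Kerr.radius (a i) (poincareInv (Λ i t) (E4.ofTimeSpace t (ξ i t)) x) →
      ‖Minkowski.bilin + ∑ j, (boostedKerrBilin (Λ j (x 0)) (E4.ofTimeSpace (x 0) (ξ j (x 0)))
        (M j) (a j) x - Minkowski.bilin)‖ ≤
        ‖Minkowski.bilin‖ + ∑ j, 4 * (|M j| / min r₀ 1) * (1 + 3 * γ) ^ 2 := by
  have E1 : ∀ j, ∀ᶠ t in atTop, j ≠ i → R + (|a j| + 1) ≤ ‖ξ i t - ξ j t‖ := by
    intro j
    by_cases hij : j = i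
    · exact Eventually.of_forall fun t h ↦ (h hij).elim
    · exact ((hsep i j (Ne.symm hij)).eventually_ge_atTop _).mono fun t ht _ ↦ ht
  filter_upwards [eventually_all.2 E1] with t ht x hx0 hxR hxr
  have hρ : 0 < min r₀ 1 := lt_min hr₀ one_pos
  -- every painted radius is at least `min r₀ 1` at `x`
  have hrad : ∀ j, min r₀ 1 ≤ Kerr.radius (a j) (poincareInv (Λ j t) (E4.ofTimeSpace t (ξ j t)) x) := by
    intro j
    by_cases hij : j = i
    · subst hij; exact (min_le_left _ _).trans hxr
    · have hfar : |a j| + 1 ≤ ‖E4.spatial x - ξ j t‖ := by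
        have htri : ‖ξ i t - ξ j t‖ ≤ ‖E4.spatial x - ξ i t‖ + ‖E4.spatial x - ξ j t‖ := by
          calc ‖ξ i t - ξ j t‖ = ‖(E4.spatial x - ξ j t) - (E4.spatial x - ξ i t)‖ := by
                congr 1; abel
            _ ≤ ‖E4.spatial x - ξ j t‖ + ‖E4.spatial x - ξ i t‖ := norm_sub_le _ _
            _ = _ := add_comm _ _
        linarith [ht j hij]
      have h1 := sq_sub_sq_le_radius_poincareInv_sq (Λ j t) (a j) t (ξ j t) hx0
      have h2 : (1 : ℝ) ^ 2 ≤ Kerr.radius (a j) (poincareInv (Λ j t) (E4.ofTimeSpace t (ξ j t)) x) ^ 2 := by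
        have h3 : (|a j| + 1) ^ 2 ≤ ‖E4.spatial x - ξ j t‖ ^ 2 :=
          pow_le_pow_left₀ (by positivity) hfar 2
        nlinarith [sq_abs (a j), abs_nonneg (a j)]
      exact (min_le_right _ _).trans
        ((pow_le_pow_iff_left₀ zero_le_one (Kerr.radius_nonneg _ _) two_ne_zero).mp h2)
  have hterm : ∀ j, ‖boostedKerrBilin (Λ j (x 0)) (E4.ofTimeSpace (x 0) (ξ j (x 0))) (M j) (a j) x -
      Minkowski.bilin‖ ≤ 4 * (|M j| / min r₀ 1) * (1 + 3 * γ) ^ 2 := by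
    intro j
    rw [hx0]
    have hrp : 0 < Kerr.radius (a j) (poincareInv (Λ j t) (E4.ofTimeSpace t (ξ j t)) x) :=
      hρ.trans_le (hrad j)
    have h1 := norm_boostedKerrBilin_sub_minkowski_le (Λ j t) (E4.ofTimeSpace t (ξ j t)) (M j) (a j) hrp
    have hH : |Kerr.scalarH (M j) (a j) (poincareInv (Λ j t) (E4.ofTimeSpace t (ξ j t)) x)| ≤
        |M j| / min r₀ 1 :=
      (abs_scalarH_le (M j) (a j) hrp).trans (div_le_div_of_nonneg_left (abs_nonneg _) hρ (hrad j))
    have hLi : ‖(((Λ j t : E4 ≃L[ℝ] E4).symm : E4 →L[ℝ] E4))‖ ^ 2 ≤ (1 + 3 * γ) ^ 2 :=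
      pow_le_pow_left₀ (norm_nonneg _) ((norm_lorentz_symm_le' (Λ j t)).trans (by
        linarith [hγ j t])) 2
    exact h1.trans (by gcongr)
  calc ‖Minkowski.bilin + ∑ j, (boostedKerrBilin (Λ j (x 0)) (E4.ofTimeSpace (x 0) (ξ j (x 0)))
        (M j) (a j) x - Minkowski.bilin)‖
      ≤ ‖Minkowski.bilin‖ + ‖∑ j, (boostedKerrBilin (Λ j (x 0)) (E4.ofTimeSpace (x 0) (ξ j (x 0)))
        (M j) (a j) x - Minkowski.bilin)‖ := norm_add_le _ _
    _ ≤ ‖Minkowski.bilin‖ + ∑ j, ‖boostedKerrBilin (Λ j (x 0)) (E4.ofTimeSpace (x 0) (ξ j (x 0)))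
        (M j) (a j) x - Minkowski.bilin‖ := by gcongr; exact norm_sum_le _ _
    _ ≤ ‖Minkowski.bilin‖ + ∑ j, 4 * (|M j| / min r₀ 1) * (1 + 3 * γ) ^ 2 := by
        gcongr with j _; exact hterm j

/-- `fderiv` of metric components, third order: `‖D(D(Df))(x)‖ = ‖D³f(x)‖`. [folklore] -/
theorem norm_fderiv_fderiv_fderiv_eq_norm_iteratedFDeriv {F : Type*} [NormedAddCommGroup F]
    [NormedSpace ℝ F] (f : E4 → F) (x : E4) :
    ‖fderiv ℝ (fderiv ℝ (fderiv ℝ f)) x‖ = ‖iteratedFDeriv ℝ 3 f x‖ := by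
  rw [← norm_iteratedFDeriv_fderiv (n := 2), ← norm_iteratedFDeriv_fderiv (n := 1),
    ← norm_iteratedFDeriv_fderiv (n := 0), norm_iteratedFDeriv_zero]

/-- **Registered one-line carrier form** (`slaving_norm_ansatz_le_near_hole_slaving11`) of
`eventually_norm_ansatz_le_near_hole`. [folklore] -/
theorem slaving_norm_ansatz_le_near_hole_slaving11 : open Literature.Geometry.Lorentzian Filter in ∀ {N : ℕ} {M a : Fin N → ℝ} {Λ : Fin N → ℝ → lorentzGroup} {ξ : Fin N → ℝ → E3} {γ : ℝ}, (∀ i t, |((Λ i t : E4 ≃L[ℝ] E4) (E4.basisVector 0)) 0| ≤ γ) → (∀ i j, i ≠ j → Tendsto (fun t ↦ ‖ξ i t - ξ j t‖) atTop atTop) → ∀ (i : Fin N) (R : ℝ) {r₀ : ℝ}, 0 < r₀ → ∀ᶠ t in atTop, ∀ x : E4, x 0 = t → ‖E4.spatial x - ξ i t‖ ≤ R → r₀ ≤ Kerr.radius (a i) (poincareInv (Λ i t) (E4.ofTimeSpace t (ξ i t)) x) → ‖Minkowski.bilin + ∑ j, (boostedKerrBilin (Λ j (x 0)) (E4.ofTimeSpace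 (x 0) (ξ j (x 0))) (M j) (a j) x - Minkowski.bilin)‖ ≤ ‖Minkowski.bilin‖ + ∑ j, 4 * (|M j| / min r₀ 1) * (1 + 3 * γ) ^ 2 :=
  fun hγ hsep i R _ hr₀ ↦ eventually_norm_ansatz_le_near_hole hγ hsep i R hr₀

end Summit.FinalStateConjecture.FinalStateConjecture.Theorems.SublinearIsFree.Slaving

end
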